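import Mathlib
import Summits.ValiantsHypothesis.ValiantsHypothesis.Theorems.GirthSidonMomentCurveElusiveCoveringGirth

/-!
# Route GirthSidon — crux `PolySwallowForcesShortRelation` (stmt-ValiantsHypothesis-6537), line `two_ended_honesty`, stub `stub_honestTargets`

Registered stub 1 of the planner's skeleton
`Cruxes/PolySwallowForcesShortRelation/Lines/two_ended_honesty.lean` (val-width-lines-2, 2026-08-27):
HONEST TARGETS.  Polynomial sources `y_j ∈ ℂ[x]` of a quadratic swallower carry two valuations,
`ord₀ = natTrailingDegree` and `ord_∞ = natDegree`; with `V = span_ℂ(1, y_1, …, y_s)`, `O₀ = ord₀(V ∖ 0)`,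
`O_∞ = deg(V ∖ 0)`, a target exponent `d_i` is HONEST at `0` (resp. `∞`) when `d_i ∈ O₀ + O₀`
(resp. `O_∞ + O_∞`).  If every target is honest at one end, the exponent vector has a short additive
relation (multisets `S ≠ T` of `≤ 30` indices with equal `d`-sums).

Proof.
* **Echelon lemma for `K[X]`** (`linearIndependent_of_natDegree_injective`,
  `linearIndependent_of_natTrailingDegree_injective`, `card_le_finrank_of_subset_natDegrees`,
  `card_le_finrank_of_subset_natTrailingDegrees`): nonzero polynomials with pairwise distinct degrees
  (resp. trailing degrees) are linearly independent — look at the coefficient at the largest degree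
  (resp. smallest trailing degree) carrying a nonzero scalar — so a finite-dimensional `W ⊂ K[X]` has
  at most `finrank W` degrees and at most `finrank W` trailing degrees of nonzero elements.  (Mathlib's
  `Polynomial.Sequence` covers only sequences `deg S_i = i`; the tree's
  `Theorems.linearIndependent_of_order_injective` is the `K((t))` version.)
* `finrank V ≤ s + 1` (`finrank_range_le_card` on `Fin.cons 1 y`), so the finitely many orders used by
  the honesty witnesses form `U ⊂ ℤ` with `|U| ≤ 2 (s + 1)` and `d(Fin m) ⊆ U + U`.
* Numerics: `s^10 ≤ 512 m^9` gives `(2s+2)^10 ≤ 2^29 m^9`, hence `|U|^20 ≤ 2^58 m^18 ≤ m^19` for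
  `m ≥ 2^58`.
* A non-injective `d` has the relation `{i} ≠ {j}`; an injective one is handled by the LANDED girth
  engine `Theorems.stub_coveringGirth` (`GirthSidonMomentCurveElusiveCoveringGirth.lean`: loops, dense
  core, Moore bound with `k = 30`, `m ≥ 4098^25`).

The statement below is the registered signature VERBATIM with the line-local definitions `sourceSpan`,
`HonestAtZero`, `HonestAtInfty` unfolded (a Theorems file cannot import a `Cruxes` module), so the
skeleton's `sorry` closes by `exact Theorems.stub_honestTargets`.  The swallowing hypotheses
(`Γ` quadratic, `Γ_i(y) = x^{d_i}`) are carried but idle: honesty plus the two echelon counts suffice.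

HONEST FRAMING: bookkeeping over a landed engine; the content of the crux is the sibling stub
`stub_doublyBornTargets` (open, conjecture-grade).  Nothing here bears on item 6537 itself beyond this
half, nor on `VP ≠ VNP`.
-/

-- Sub = Summit layout duplicates the namespace component
set_option linter.dupNamespace false

namespace Summit.ValiantsHypothesis.ValiantsHypothesis.Theorems

section PolyEchelon

variable {K : Type*} [Field K]

open Polynomial

/-- Nonzero polynomials with pairwise distinct degrees are linearly independent: in a vanishing
linear combination, the coefficient at the largest degree carrying a nonzero scalar is that scalar
times a leading coefficient. [folklore] -/
theorem linearIndependent_of_natDegree_injective {ι : Type*} (w : ι → K[X])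
    (hw : ∀ i, w i ≠ 0) (hinj : Function.Injective fun i => (w i).natDegree) :
    LinearIndependent K w := by
  classical
  rw [linearIndependent_iff']
  intro S c hc
  by_contra hex
  push Not at hex
  obtain ⟨i, hi, hci⟩ := hex
  set T := S.filter fun j => c j ≠ 0 with hT
  have hTne : T.Nonempty := ⟨i, Finset.mem_filter.2 ⟨hi, hci⟩⟩
  obtain ⟨j₀, hj₀, hmax⟩ := T.exists_max_image (fun j => (w j).natDegree) hTne
  have hj₀S : j₀ ∈ S := (Finset.mem_filter.1 hj₀).1
  have hcj₀ : c j₀ ≠ 0 := (Finset.mem_filter.1 hj₀).2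
  have hcoef := congr_arg (fun p : K[X] => p.coeff (w j₀).natDegree) hc
  simp only [finsetSum_coeff, coeff_smul, coeff_zero, smul_eq_mul] at hcoef
  rw [Finset.sum_eq_single j₀] at hcoef
  · exact (mul_ne_zero hcj₀ (leadingCoeff_ne_zero.2 (hw j₀))) hcoef
  · intro j hjS hj
    by_cases hcj : c j = 0
    · simp [hcj]
    · have hjT : j ∈ T := Finset.mem_filter.2 ⟨hjS, hcj⟩
      have hle := hmax j hjT
      have hne : (w j).natDegree ≠ (w j₀).natDegree := fun h => hj (hinj h)
      have hlt : (w j).natDegree < (w j₀).natDegree := lt_of_le_of_ne hle hne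
      simp [coeff_eq_zero_of_natDegree_lt hlt]
  · intro h; exact absurd hj₀S h

/-- Nonzero polynomials with pairwise distinct trailing degrees are linearly independent: in a
vanishing linear combination, the coefficient at the smallest trailing degree carrying a nonzero
scalar is that scalar times a trailing coefficient. [folklore] -/
theorem linearIndependent_of_natTrailingDegree_injective {ι : Type*} (w : ι → K[X])
    (hw : ∀ i, w i ≠ 0) (hinj : Function.Injective fun i => (w i).natTrailingDegree) :
    LinearIndependent K w := by
  classical
  rw [linearIndependent_iff']
  intro S c hc
  by_contra hex
  push Not at hex
  obtain ⟨i, hi, hci⟩ := hex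
  set T := S.filter fun j => c j ≠ 0 with hT
  have hTne : T.Nonempty := ⟨i, Finset.mem_filter.2 ⟨hi, hci⟩⟩
  obtain ⟨j₀, hj₀, hmin⟩ := T.exists_min_image (fun j => (w j).natTrailingDegree) hTne
  have hj₀S : j₀ ∈ S := (Finset.mem_filter.1 hj₀).1
  have hcj₀ : c j₀ ≠ 0 := (Finset.mem_filter.1 hj₀).2
  have hcoef := congr_arg (fun p : K[X] => p.coeff (w j₀).natTrailingDegree) hc
  simp only [finsetSum_coeff, coeff_smul, coeff_zero, smul_eq_mul] at hcoef
  rw [Finset.sum_eq_single j₀] at hcoef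
  · exact (mul_ne_zero hcj₀ (trailingCoeff_nonzero_iff_nonzero.2 (hw j₀))) hcoef
  · intro j hjS hj
    by_cases hcj : c j = 0
    · simp [hcj]
    · have hjT : j ∈ T := Finset.mem_filter.2 ⟨hjS, hcj⟩
      have hle := hmin j hjT
      have hne : (w j₀).natTrailingDegree ≠ (w j).natTrailingDegree := fun h => hj (hinj h.symm)
      have hlt : (w j₀).natTrailingDegree < (w j).natTrailingDegree := lt_of_le_of_ne hle hne
      simp [coeff_eq_zero_of_lt_natTrailingDegree hlt]
  · intro h; exact absurd hj₀S h

/-- **Echelon count at `∞`.** A finite set of degrees of nonzero elements of a finite-dimensional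
subspace `W ⊂ K[X]` has at most `finrank W` elements. [folklore] -/
theorem card_le_finrank_of_subset_natDegrees (W : Submodule K K[X]) [Module.Finite K W]
    (F : Finset ℕ) (hF : ∀ e ∈ F, ∃ v ∈ W, v ≠ 0 ∧ v.natDegree = e) :
    F.card ≤ Module.finrank K W := by
  classical
  choose! v hvW hv0 hve using hF
  let f : F → W := fun e => ⟨v e, hvW e e.2⟩
  have hli : LinearIndependent K f := by
    have hli' : LinearIndependent K (fun e : F => (f e : K[X])) := by
      refine linearIndependent_of_natDegree_injective _ (fun e => hv0 e e.2) ?_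
      intro e e' h
      apply Subtype.ext
      simp only [f] at h
      rwa [hve e e.2, hve e' e'.2] at h
    exact LinearIndependent.of_comp W.subtype hli'
  simpa using hli.fintype_card_le_finrank

/-- **Echelon count at `0`.** A finite set of trailing degrees of nonzero elements of a
finite-dimensional subspace `W ⊂ K[X]` has at most `finrank W` elements. [folklore] -/
theorem card_le_finrank_of_subset_natTrailingDegrees (W : Submodule K K[X]) [Module.Finite K W]
    (F : Finset ℕ) (hF : ∀ e ∈ F, ∃ v ∈ W, v ≠ 0 ∧ v.natTrailingDegree = e) :
    F.card ≤ Module.finrank K W := by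
  classical
  choose! v hvW hv0 hve using hF
  let f : F → W := fun e => ⟨v e, hvW e e.2⟩
  have hli : LinearIndependent K f := by
    have hli' : LinearIndependent K (fun e : F => (f e : K[X])) := by
      refine linearIndependent_of_natTrailingDegree_injective _ (fun e => hv0 e e.2) ?_
      intro e e' h
      apply Subtype.ext
      simp only [f] at h
      rwa [hve e e.2, hve e' e'.2] at h
    exact LinearIndependent.of_comp W.subtype hli'
  simpa using hli.fintype_card_le_finrank

/-- The source span `span_K(1, y_1, …, y_s)` has dimension at most `s + 1`. [folklore] -/
theorem finrank_span_insert_one_range_le {s : ℕ} (y : Fin s → K[X]) :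
    Module.finrank K (Submodule.span K (insert (1 : K[X]) (Set.range y))) ≤ s + 1 := by
  rw [← Fin.range_cons]
  exact (finrank_range_le_card (R := K) _).trans (by simp)

end PolyEchelon

/-- The arithmetic of the line: `s^10 ≤ 512 m^9`, `c ≤ 2 (s + 1)` and `m ≥ 2^58` give
`c^20 ≤ m^19` (via `(2s+2)^10 ≤ 2^29 m^9`). [folklore] -/
theorem pow_twenty_le_of_honest_count {s m c : ℕ} (hs : s ^ 10 ≤ 512 * m ^ 9) (hm : 2 ^ 58 ≤ m)
    (hc : c ≤ 2 * (s + 1)) : c ^ 20 ≤ m ^ 19 := by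
  have h1 : (2 * (s + 1)) ^ 10 ≤ 2 ^ 29 * m ^ 9 := by
    rcases Nat.eq_zero_or_pos s with rfl | hs1
    · have h9 : 1 ≤ m ^ 9 := Nat.one_le_pow _ _ (by omega)
      calc (2 * (0 + 1)) ^ 10 = 1024 := by norm_num
        _ ≤ 2 ^ 29 * 1 := by norm_num
        _ ≤ 2 ^ 29 * m ^ 9 := Nat.mul_le_mul_left _ h9
    · calc (2 * (s + 1)) ^ 10 ≤ (4 * s) ^ 10 := Nat.pow_le_pow_left (by omega) 10
        _ = 2 ^ 20 * s ^ 10 := by ring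
        _ ≤ 2 ^ 20 * (512 * m ^ 9) := Nat.mul_le_mul_left _ hs
        _ = 2 ^ 29 * m ^ 9 := by ring
  have h2 : (2 * (s + 1)) ^ 20 ≤ m ^ 19 := by
    calc (2 * (s + 1)) ^ 20 = ((2 * (s + 1)) ^ 10) ^ 2 := by ring
      _ ≤ (2 ^ 29 * m ^ 9) ^ 2 := Nat.pow_le_pow_left h1 2
      _ = 2 ^ 58 * m ^ 18 := by ring
      _ ≤ m * m ^ 18 := Nat.mul_le_mul_right _ hm
      _ = m ^ 19 := by ring
  exact le_trans (Nat.pow_le_pow_left hc 20) h2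

/-- **Stub `stub_honestTargets` of line `two_ended_honesty` (crux `PolySwallowForcesShortRelation`,
stmt-ValiantsHypothesis-6537), registered signature with `sourceSpan` / `HonestAtZero` / `HonestAtInfty`
unfolded.**  If every target exponent `d_i` is honest at `0` or at `∞` for the sources `y`
(`d_i = ord f + ord g` for nonzero `f, g ∈ span_ℂ(1, y)`, `ord ∈ {natTrailingDegree, natDegree}` the
same for both), and `s^10 ≤ 512 m^9` with `m ≥ max m_girth 2^58`, then some multisets `S ≠ T` of
`≤ 30` indices have equal `d`-sums: `d ⊆ U + U` for the `≤ 2(s+1)` orders used, `|U|^20 ≤ m^19`, and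
either `d` is not injective (relation `{i} ≠ {j}`) or `Theorems.stub_coveringGirth` applies.
[cite: BondySimonovits1974, Thm. 1] -/
theorem stub_honestTargets :
    ∃ m₀ : ℕ, ∀ m ≥ m₀, ∀ (d : Fin m → ℕ) (s : ℕ), s ^ 10 ≤ 512 * m ^ 9 →
      ∀ (Γ : Fin m → MvPolynomial (Fin s) ℂ) (y : Fin s → Polynomial ℂ),
        (∀ i, (Γ i).totalDegree ≤ 2) → (∀ i, MvPolynomial.aeval y (Γ i) = Polynomial.X ^ d i) →
        (∀ i, (∃ f ∈ Submodule.span ℂ (insert (1 : Polynomial ℂ) (Set.range y)),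
                ∃ g ∈ Submodule.span ℂ (insert (1 : Polynomial ℂ) (Set.range y)),
                  f ≠ 0 ∧ g ≠ 0 ∧ f.natTrailingDegree + g.natTrailingDegree = d i) ∨
              (∃ f ∈ Submodule.span ℂ (insert (1 : Polynomial ℂ) (Set.range y)),
                ∃ g ∈ Submodule.span ℂ (insert (1 : Polynomial ℂ) (Set.range y)),
                  f ≠ 0 ∧ g ≠ 0 ∧ f.natDegree + g.natDegree = d i)) →
        ∃ S T : Multiset (Fin m), S ≠ T ∧ Multiset.card S ≤ 30 ∧ Multiset.card T ≤ 30 ∧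
          (S.map d).sum = (T.map d).sum := by
  obtain ⟨m₁, hgirth⟩ := stub_coveringGirth
  refine ⟨max m₁ (2 ^ 58), fun m hm d s hs _Γ y _ _ hhon => ?_⟩
  classical
  have hm₁ : m₁ ≤ m := le_trans (le_max_left _ _) hm
  have hm58 : 2 ^ 58 ≤ m := le_trans (le_max_right _ _) hm
  -- a non-injective exponent vector has a relation of length one
  by_cases hinj : Function.Injective d
  swap
  · obtain ⟨i, j, hij, hne⟩ := Function.not_injective_iff.1 hinj
    exact ⟨{i}, {j}, by simpa using hne, by simp, by simp, by simpa using hij⟩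
  -- the source span and its dimension
  set W : Submodule ℂ (Polynomial ℂ) := Submodule.span ℂ (insert (1 : Polynomial ℂ) (Set.range y))
    with hWdef
  haveI : Module.Finite ℂ W := Module.Finite.span_of_finite ℂ ((Set.finite_range y).insert 1)
  have hfin : Module.finrank ℂ W ≤ s + 1 := finrank_span_insert_one_range_le y
  -- honesty witnesses, uniformly: an order function `o i ∈ {natTrailingDegree, natDegree}`
  have hw : ∀ i, ∃ f g : Polynomial ℂ, f ∈ W ∧ g ∈ W ∧ f ≠ 0 ∧ g ≠ 0 ∧
      (f.natTrailingDegree + g.natTrailingDegree = d i ∨ f.natDegree + g.natDegree = d i) := by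
    intro i
    rcases hhon i with ⟨f, hf, g, hg, hf0, hg0, h⟩ | ⟨f, hf, g, hg, hf0, hg0, h⟩
    · exact ⟨f, g, hf, hg, hf0, hg0, Or.inl h⟩
    · exact ⟨f, g, hf, hg, hf0, hg0, Or.inr h⟩
  choose f g hfW hgW hf0 hg0 hfg using hw
  -- the finitely many witnesses and the orders they use
  let P : Finset (Polynomial ℂ) := Finset.univ.image f ∪ Finset.univ.image g
  have hPW : ∀ p ∈ P, p ∈ W := by
    intro p hp
    rcases Finset.mem_union.1 hp with hp | hp
    · obtain ⟨i, -, rfl⟩ := Finset.mem_image.1 hp; exact hfW i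
    · obtain ⟨i, -, rfl⟩ := Finset.mem_image.1 hp; exact hgW i
  have hP0 : ∀ p ∈ P, p ≠ 0 := by
    intro p hp
    rcases Finset.mem_union.1 hp with hp | hp
    · obtain ⟨i, -, rfl⟩ := Finset.mem_image.1 hp; exact hf0 i
    · obtain ⟨i, -, rfl⟩ := Finset.mem_image.1 hp; exact hg0 i
  have hfP : ∀ i, f i ∈ P := fun i =>
    Finset.mem_union.2 (Or.inl (Finset.mem_image.2 ⟨i, Finset.mem_univ _, rfl⟩))
  have hgP : ∀ i, g i ∈ P := fun i =>
    Finset.mem_union.2 (Or.inr (Finset.mem_image.2 ⟨i, Finset.mem_univ _, rfl⟩))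
  let O₀ : Finset ℕ := P.image Polynomial.natTrailingDegree
  let Oinf : Finset ℕ := P.image Polynomial.natDegree
  have hO₀ : O₀.card ≤ s + 1 := by
    refine le_trans (card_le_finrank_of_subset_natTrailingDegrees W O₀ ?_) hfin
    intro e he
    obtain ⟨p, hp, rfl⟩ := Finset.mem_image.1 he
    exact ⟨p, hPW p hp, hP0 p hp, rfl⟩
  have hOinf : Oinf.card ≤ s + 1 := by
    refine le_trans (card_le_finrank_of_subset_natDegrees W Oinf ?_) hfin
    intro e he
    obtain ⟨p, hp, rfl⟩ := Finset.mem_image.1 he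
    exact ⟨p, hPW p hp, hP0 p hp, rfl⟩
  let U : Finset ℤ := (O₀ ∪ Oinf).image (fun n : ℕ => (n : ℤ))
  have hUcard : U.card ≤ 2 * (s + 1) := by
    calc U.card ≤ (O₀ ∪ Oinf).card := Finset.card_image_le
      _ ≤ O₀.card + Oinf.card := Finset.card_union_le _ _
      _ ≤ (s + 1) + (s + 1) := Nat.add_le_add hO₀ hOinf
      _ = 2 * (s + 1) := by ring
  have hU : U.card ^ 20 ≤ m ^ 19 := pow_twenty_le_of_honest_count hs hm58 hUcard
  -- the cover `d ⊆ U + U`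
  have hmem₀ : ∀ p ∈ P, (p.natTrailingDegree : ℤ) ∈ U := fun p hp =>
    Finset.mem_image.2 ⟨_, Finset.mem_union.2 (Or.inl (Finset.mem_image.2 ⟨p, hp, rfl⟩)), rfl⟩
  have hmeminf : ∀ p ∈ P, (p.natDegree : ℤ) ∈ U := fun p hp =>
    Finset.mem_image.2 ⟨_, Finset.mem_union.2 (Or.inr (Finset.mem_image.2 ⟨p, hp, rfl⟩)), rfl⟩
  have hcov : ∀ i, ∃ a ∈ U, ∃ b ∈ U, (d i : ℤ) = a + b := by
    intro i
    rcases hfg i with h | h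
    · refine ⟨_, hmem₀ _ (hfP i), _, hmem₀ _ (hgP i), ?_⟩
      rw [← h]; push_cast; rfl
    · refine ⟨_, hmeminf _ (hfP i), _, hmeminf _ (hgP i), ?_⟩
      rw [← h]; push_cast; rfl
  exact hgirth m hm₁ d hinj U hU hcov

/-! ## Cover form (appended 2026-08-27 for the sibling stub `stub_doublyBornTargets`, val-width-6537-p2)

CROSS-HONEST targets `d_i = ord₀ f + deg g` also lie in `U + U` for the same `U = O₀ ∪ O_∞`, so the
girth engine swallows them: (i) `U` as ONE finset of size `≤ 2 (s + 1)`, (ii) the arithmetic with a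
free constant `C` (`s^10 ≤ C m^9`, for repeated majority splits), (iii) the relation theorem for the
four-way disjunction `d_i ∈ {ord₀ f, deg f} + {ord₀ g, deg g}` (`stub_honestTargets` = `0/0 ∨ ∞/∞`). -/

section OrderSet

variable {K : Type*} [Field K]

open Polynomial

/-- The degrees of the nonzero elements of a finite-dimensional `W ⊂ K[X]` form a finite set.
[folklore] -/
theorem natDegrees_finite (W : Submodule K K[X]) [Module.Finite K W] :
    ({e : ℕ | ∃ v ∈ W, v ≠ 0 ∧ v.natDegree = e}).Finite := by
  classical
  by_contra hinf
  obtain ⟨F, hF, hcard⟩ := Set.Infinite.exists_subset_card_eq hinf (Module.finrank K W + 1)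
  have h := card_le_finrank_of_subset_natDegrees W F (fun e he => hF (Finset.mem_coe.2 he))
  omega

/-- The trailing degrees of the nonzero elements of a finite-dimensional `W ⊂ K[X]` form a finite
set. [folklore] -/
theorem natTrailingDegrees_finite (W : Submodule K K[X]) [Module.Finite K W] :
    ({e : ℕ | ∃ v ∈ W, v ≠ 0 ∧ v.natTrailingDegree = e}).Finite := by
  classical
  by_contra hinf
  obtain ⟨F, hF, hcard⟩ := Set.Infinite.exists_subset_card_eq hinf (Module.finrank K W + 1)
  have h := card_le_finrank_of_subset_natTrailingDegrees W F (fun e he => hF (Finset.mem_coe.2 he))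
  omega

/-- **The two-ended order set of the source span.**  For `y : Fin s → K[X]` there is ONE finset
`U ⊂ ℕ` with `|U| ≤ 2 (s + 1)` containing the trailing degree and the degree of every nonzero
element of `span_K(1, y_1, …, y_s)` (`U = O₀ ∪ O_∞`, two echelon counts). [folklore] -/
theorem exists_twoEnded_orderFinset {s : ℕ} (y : Fin s → K[X]) :
    ∃ U : Finset ℕ, U.card ≤ 2 * (s + 1) ∧
      ∀ f ∈ Submodule.span K (insert (1 : K[X]) (Set.range y)), f ≠ 0 →
        f.natTrailingDegree ∈ U ∧ f.natDegree ∈ U := by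
  classical
  set W : Submodule K K[X] := Submodule.span K (insert (1 : K[X]) (Set.range y)) with hWdef
  haveI : Module.Finite K W := Module.Finite.span_of_finite K ((Set.finite_range y).insert 1)
  have hfin : Module.finrank K W ≤ s + 1 := finrank_span_insert_one_range_le y
  refine ⟨(natTrailingDegrees_finite W).toFinset ∪ (natDegrees_finite W).toFinset, ?_, ?_⟩
  · have h₀ : (natTrailingDegrees_finite W).toFinset.card ≤ s + 1 :=
      le_trans (card_le_finrank_of_subset_natTrailingDegrees W _
        (fun e he => (natTrailingDegrees_finite W).mem_toFinset.1 he)) hfin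
    have hinf : (natDegrees_finite W).toFinset.card ≤ s + 1 :=
      le_trans (card_le_finrank_of_subset_natDegrees W _
        (fun e he => (natDegrees_finite W).mem_toFinset.1 he)) hfin
    calc ((natTrailingDegrees_finite W).toFinset ∪ (natDegrees_finite W).toFinset).card
        ≤ (natTrailingDegrees_finite W).toFinset.card + (natDegrees_finite W).toFinset.card :=
          Finset.card_union_le _ _
      _ ≤ (s + 1) + (s + 1) := Nat.add_le_add h₀ hinf
      _ = 2 * (s + 1) := by ring
  · intro f hf hf0
    exact ⟨Finset.mem_union_left _ ((natTrailingDegrees_finite W).mem_toFinset.2 ⟨f, hf, hf0, rfl⟩),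
      Finset.mem_union_right _ ((natDegrees_finite W).mem_toFinset.2 ⟨f, hf, hf0, rfl⟩)⟩

end OrderSet

/-- The arithmetic with a free constant: `s^10 ≤ C m^9`, `c ≤ 2 (s + 1)`, `m ≥ 2^40 C^2` and
`m ≥ 3` give `c^20 ≤ m^19`. [folklore] -/
theorem pow_twenty_le_of_count {C s m c : ℕ} (hs : s ^ 10 ≤ C * m ^ 9) (hm : 2 ^ 40 * C ^ 2 ≤ m)
    (hm3 : 3 ≤ m) (hc : c ≤ 2 * (s + 1)) : c ^ 20 ≤ m ^ 19 := by
  refine le_trans (Nat.pow_le_pow_left hc 20) ?_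
  rcases Nat.eq_zero_or_pos s with rfl | hs1
  · calc (2 * (0 + 1)) ^ 20 ≤ 3 ^ 19 := by norm_num
      _ ≤ m ^ 19 := Nat.pow_le_pow_left hm3 19
  · calc (2 * (s + 1)) ^ 20 ≤ (4 * s) ^ 20 := Nat.pow_le_pow_left (by omega) 20
      _ = 2 ^ 40 * (s ^ 10) ^ 2 := by ring
      _ ≤ 2 ^ 40 * (C * m ^ 9) ^ 2 := Nat.mul_le_mul_left _ (Nat.pow_le_pow_left hs 2)
      _ = (2 ^ 40 * C ^ 2) * m ^ 18 := by ring
      _ ≤ m * m ^ 18 := Nat.mul_le_mul_right _ hm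
      _ = m ^ 19 := by ring

/-- **Cover form of the honest-targets stub (free constant `C`, cross-honest targets included).**
For every `C` there is `m₀` such that for `m ≥ m₀`, `s^10 ≤ C m^9` and sources `y : Fin s → ℂ[X]`:
if every target exponent is `d_i = a + b` with `a ∈ {ord₀ f, deg f}`, `b ∈ {ord₀ g, deg g}` for some
nonzero `f, g ∈ span_ℂ(1, y)` (honest at `0`, honest at `∞`, or CROSS-honest), then multisets
`S ≠ T` of `≤ 30` indices have equal `d`-sums.  Proof: `d ⊆ U + U` for the two-ended order set
`U` (`|U| ≤ 2(s+1)`, `|U|^20 ≤ m^19` once `m ≥ 2^40 C^2 + 3`); non-injective `d` ⇒ `{i} ≠ {j}`,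
injective ⇒ `Theorems.stub_coveringGirth`. [cite: BondySimonovits1974, Thm. 1] -/
theorem coveredTargets_relation (C : ℕ) :
    ∃ m₀ : ℕ, ∀ m ≥ m₀, ∀ (d : Fin m → ℕ) (s : ℕ), s ^ 10 ≤ C * m ^ 9 →
      ∀ (y : Fin s → Polynomial ℂ),
        (∀ i, ∃ f ∈ Submodule.span ℂ (insert (1 : Polynomial ℂ) (Set.range y)),
            ∃ g ∈ Submodule.span ℂ (insert (1 : Polynomial ℂ) (Set.range y)), f ≠ 0 ∧ g ≠ 0 ∧
              (f.natTrailingDegree + g.natTrailingDegree = d i ∨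
                f.natTrailingDegree + g.natDegree = d i ∨
                f.natDegree + g.natTrailingDegree = d i ∨
                f.natDegree + g.natDegree = d i)) →
        ∃ S T : Multiset (Fin m), S ≠ T ∧ Multiset.card S ≤ 30 ∧ Multiset.card T ≤ 30 ∧
          (S.map d).sum = (T.map d).sum := by
  obtain ⟨m₁, hgirth⟩ := stub_coveringGirth
  refine ⟨max m₁ (2 ^ 40 * C ^ 2 + 3), fun m hm d s hs y hcov => ?_⟩
  classical
  have hm₁ : m₁ ≤ m := le_trans (le_max_left _ _) hm
  have hm' : 2 ^ 40 * C ^ 2 + 3 ≤ m := le_trans (le_max_right _ _) hm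
  have hmC : 2 ^ 40 * C ^ 2 ≤ m := le_trans (Nat.le_add_right _ 3) hm'
  have hm3 : 3 ≤ m := le_trans (Nat.le_add_left 3 _) hm'
  -- a non-injective exponent vector has a relation of length one
  by_cases hinj : Function.Injective d
  swap
  · obtain ⟨i, j, hij, hne⟩ := Function.not_injective_iff.1 hinj
    exact ⟨{i}, {j}, by simpa using hne, by simp, by simp, by simpa using hij⟩
  -- the two-ended order set, cast to `ℤ`
  obtain ⟨U, hUcard, hU⟩ := exists_twoEnded_orderFinset (K := ℂ) y
  let Uz : Finset ℤ := U.image (fun n : ℕ => (n : ℤ))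
  have hUz : Uz.card ^ 20 ≤ m ^ 19 :=
    pow_twenty_le_of_count hs hmC hm3 (le_trans Finset.card_image_le hUcard)
  have hmemz : ∀ n ∈ U, (n : ℤ) ∈ Uz := fun n hn => Finset.mem_image.2 ⟨n, hn, rfl⟩
  have hcovz : ∀ i, ∃ a ∈ Uz, ∃ b ∈ Uz, (d i : ℤ) = a + b := by
    intro i
    obtain ⟨f, hf, g, hg, hf0, hg0, h⟩ := hcov i
    obtain ⟨hf₀, hfinf⟩ := hU f hf hf0
    obtain ⟨hg₀, hginf⟩ := hU g hg hg0
    rcases h with h | h | h | h <;>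
      first
        | exact ⟨_, hmemz _ hf₀, _, hmemz _ hg₀, by rw [← h]; push_cast; rfl⟩
        | exact ⟨_, hmemz _ hf₀, _, hmemz _ hginf, by rw [← h]; push_cast; rfl⟩
        | exact ⟨_, hmemz _ hfinf, _, hmemz _ hg₀, by rw [← h]; push_cast; rfl⟩
        | exact ⟨_, hmemz _ hfinf, _, hmemz _ hginf, by rw [← h]; push_cast; rfl⟩
  exact hgirth m hm₁ d hinj Uz hUz hcovz

end Summit.ValiantsHypothesis.ValiantsHypothesis.Theorems
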